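import Literature.NumberTheory.Automorphic.UnitaryGroupSymplecticCarriers
import Literature.NumberTheory.Automorphic.AdeleAddCharLocalNontrivial
import Literature.NumberTheory.Automorphic.FiniteAdeleFactorizable
import Literature.NumberTheory.Automorphic.RankOneFiniteAdeleWeil
import Literature.NumberTheory.Weil1964.AdicCompletionLerayCocycleMu8
import Literature.RepresentationTheory.HeisenbergGroup.ImplementerExtensionIso
import HarnessLib

/-!
# The local non-archimedean splitting datum of a unitary group in the metaplectic group
# ([GelbartRogawski1991, Prop. 3.1.1] / [Kudla1994, Thm 3.1], finite places): INTERFACE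

Topic `NumberTheory/GelbartRogawski1991`; namespace
`Literature.NumberTheory.GelbartRogawski1991.UnitaryDualPair.LocalSplitting`.  KERNEL ONLY: definitions with
bodies and proved lemmas; no named fact, no `sorry`.

Setting: `E/F` a quadratic extension of number fields, `c ∈ Aut(E/F)`, `δ ∈ E` with `c δ = -δ ≠ 0`, an `F`-rational
symmetric Gram matrix `T ∈ GL_N(F)` with hermitian matrix `J = T ⊗ 1` (the setting of the tree's
`UnitaryGroupSymplecticCarriers`), and a finite place `v` of `F`.  This file fixes, over the TREE's objects only, the
TYPE of the local datum from which a compatible splitting `U(J)(𝔸_F) →* Mp(𝕎_𝔸)ᶜᵒⁿᵗ` ([GelbartRogawski1991, §3.1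
Prop. 3.1.1, p. 455]) is assembled place by place ([Kudla1994, Thm 3.1]; [HarrisKudlaSweet1996, §1 (1.11)–(1.19)];
[MoeglinVignerasWaldspurger1987, Chap. 2 II.1, Chap. 3 I.3]):

* §1 the local symplectic space `𝕎_v = F_vᴺ × F_vᴺ` with the pairing `β_{𝕋_v}`, `𝕋_v = T ⊗ 1` (`localPairing`), its
  symplectic group `LocalSp` (= LITERALLY the codomain of `UnitaryGroup.localPiToSymplectic v`), the Lagrangian
  `lagrangianY = 0 × F_vᴺ` (`orthogonal_lagrangianY`; any Lagrangian `ℓ`, `ℓ^⊥ = ℓ`, may be used below), the local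
  smooth Schrödinger model `localSchrodinger = schrodingerSB β_{𝕋_v} ψ_v` on `𝒮(F_vᴺ)` with `ψ_v = adeleAddCharAt F v`
  (placewise the formula of the global `adelicSchrodinger F (Fin N) 𝕋`), its metaplectic group of pairs
  `LocalMp = MpPsi localSchrodinger` and the Leray cocycles `localLeray … ψ' hψ' ℓ hℓ : CentralCocycle LocalSp ℂˣ`
  (`lerayCentralCocycle` of `Weil1964/LocalLerayCocycle`, for any continuous non-trivial character `ψ'` of `F_v`);
* §2 `iota : U(J)(F_v) →* LocalSp` on the factor form `UnitaryGroup.localPi` (IRREDUCIBLE; `iota_def`);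
* §3 the Type-valued DATUM `LocalSplittingDatum … v μ ℓ hℓ` = ⟨a normalised implementer section `r` of the
  Schrödinger model whose multiplier `c_r` IS a Leray cocycle `c^{ψ'}_ℓ` for some `ψ'` ([Rangarao1993, Thm 4.1]:
  `ψ' = ψ_v(½·)`; [MoeglinVignerasWaldspurger1987, Chap. 3 I.3]), uniqueness of implementers up to scalars, Kudla's
  splitting function `β : U(J)(F_v) → ℂˣ` with `β(gg') c_r(ι g, ι g') = β(g) β(g')` ([Kudla1994, Thm 3.1]), and
  smoothness of `k ↦ β(k)⁻¹ r(ι k)`⟩ (v2, 2026-08-21: `∂β` is typed against the multiplier of `r` itself, so the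
  normalisation `ψ'` of the section — Rao's `½` — never has to match a convention fixed in advance), and what is
  DERIVED from it in the kernel: the homomorphism `localSplitting D : U(J)(F_v) →* LocalMp` over `ι`
  (`proj_localSplitting`), the representation `localOmega D` of `U(J)(F_v)` on `𝒮(F_vᴺ)` by implementers (the
  placewise input of `Automorphic/FiniteAdeleWeilAssembly.finiteAdeleRep`); the unramified clause
  ([GelbartRogawski1991, §3.1 (3.1.3), p. 456]: `U(J)(𝒪_v)` fixes `1_{𝒪_vᴺ}`) is stated inline by its consumers.

`LocalSplittingDatum` is DATA to be instantiated (by the files constructing Kudla's `β` and the Leray-normalised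
section), never a hypothesis of a named statement.  Written for the kernel construction of the cited input `hGRU` of
the Hodge-CM period-theorem package (stage-1 cell `pub-hodgecm`, seats GR-1 ∕ GR-2, 2026-08-21); nothing here is a claim
of the manuscripts adjudicated by that cell.

## References

* S. Gelbart, J. Rogawski, Invent. Math. 105 (1991) 445–472, §3.1 pp. 454–457 [GelbartRogawski1991].
* S. S. Kudla, Israel J. Math. 87 (1994) 361–401, Thm 3.1 [Kudla1994].
* M. Harris, S. S. Kudla, W. J. Sweet, J. Amer. Math. Soc. 9 (1996) 941–1004, §1 [HarrisKudlaSweet1996].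
* C. Mœglin, M.-F. Vignéras, J.-L. Waldspurger, LNM 1291 (1987), Chap. 2 II.1, Chap. 3 I.3
  [MoeglinVignerasWaldspurger1987].
* R. Ranga Rao, Pacific J. Math. 157 (1993) 335–371, Thm 4.1 [Rangarao1993].
-/

set_option autoImplicit false

noncomputable section

open NumberField IsDedekindDomain MeasureTheory Matrix
open Literature.RepresentationTheory.HeisenbergGroup
open Literature.NumberTheory.Automorphic Literature.NumberTheory.Weil1964
open Literature.NumberTheory.GaloisRepresentations.IsNonarchimedeanLocalField

namespace Literature.NumberTheory.GelbartRogawski1991.UnitaryDualPair.LocalSplitting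

universe u

variable (F : Type) [Field F] [NumberField F] (E : Type) [Field E] [NumberField E] [Algebra F E]
  [Algebra.IsQuadraticExtension F E] (c : E ≃ₐ[F] E) (N : ℕ)
  {δ : E} (hcδ : c δ = -δ) (hδ : δ ≠ 0) {d : F} (hd : δ * δ = algebraMap F E d)
  (T : Matrix (Fin N) (Fin N) F) (hT : T.IsSymm) (hTd : IsUnit T.det)
  {J : Matrix (Fin N) (Fin N) E} (hJ : J = T.map (algebraMap F E))
  (v : HeightOneSpectrum (𝓞 F))

/-! ## §1 The local symplectic space, Lagrangian, Schrödinger model and Leray cocycle at `v` -/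

/-- `𝕋_v = T ⊗_F F_v ∈ M_N(F_v)`. [folklore] -/
abbrev localGram : Matrix (Fin N) (Fin N) (v.adicCompletion F) := T.map (algebraMap F (v.adicCompletion F))

/-- `β_{𝕋_v}(x, y) = ⟨x, 𝕋_v y⟩` — the duality of `X_v = F_vᴺ` with `Y_v = F_vᴺ` used by the tree's
`UnitaryGroup.localPiToSymplectic v` (Mathlib `Matrix.toLinearMap₂'`). [folklore] -/
abbrev localPairing :
    (Fin N → v.adicCompletion F) →ₗ[v.adicCompletion F] (Fin N → v.adicCompletion F) →ₗ[v.adicCompletion F]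
      v.adicCompletion F :=
  Matrix.toLinearMap₂' (v.adicCompletion F) (localGram F N T v)

/-- `Sp(𝕎_v)`, `𝕎_v = F_vᴺ × F_vᴺ` with the alternating form of `polar β_{𝕋_v}` — LITERALLY the codomain of
`UnitaryGroup.localPiToSymplectic v`. [folklore] -/
abbrev LocalSp : Subgroup (((Fin N → v.adicCompletion F) × (Fin N → v.adicCompletion F)) ≃ₗ[v.adicCompletion F]
    ((Fin N → v.adicCompletion F) × (Fin N → v.adicCompletion F))) :=
  symplecticGroup (polar (localPairing F N T v))

/-- the Lagrangian `ℓ = 0 × Y_v` of `𝕎_v` (the one stabilised by the Siegel parabolic of the Schrödinger model on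
`𝒮(X_v)`; CONVENTION to be confirmed against `SchrodingerSiegelParabolic` in K3d — the two choices give
cohomologous Leray cocycles). [folklore] -/
def lagrangianY : Submodule (v.adicCompletion F) ((Fin N → v.adicCompletion F) × (Fin N → v.adicCompletion F)) :=
  Submodule.prod ⊥ ⊤

/-- `𝕋_v` is invertible (its determinant is a unit). [folklore] -/
private theorem isUnit_localGram (hTd : IsUnit T.det) : IsUnit (localGram F N T v) :=
  (Matrix.isUnit_iff_isUnit_det _).2 (UnitaryGroup.isUnit_det_map (algebraMap F (v.adicCompletion F)) hTd)

/-- `x ↦ ⟨x, 𝕋_v ·⟩` is injective: if `⟨x, 𝕋_v y⟩ = 0` for all `y` then `x = 0`. [folklore] -/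
private theorem eq_zero_of_forall_localPairing_eq_zero (hTd : IsUnit T.det) {x : Fin N → v.adicCompletion F}
    (h : ∀ y, localPairing F N T v x y = 0) : x = 0 := by
  have hs : Function.Surjective fun y : Fin N → v.adicCompletion F => localGram F N T v *ᵥ y :=
    Matrix.mulVec_surjective_iff_isUnit.2 (isUnit_localGram F N T v hTd)
  funext i
  obtain ⟨y, hy⟩ := hs (Pi.single i 1)
  have hy' : localGram F N T v *ᵥ y = Pi.single i 1 := hy
  have := h y
  rw [Matrix.toLinearMap₂'_apply', hy', dotProduct_single, mul_one] at this
  exact this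

/-- `y ↦ ⟨·, 𝕋_v y⟩` is injective: if `⟨x, 𝕋_v y⟩ = 0` for all `x` then `y = 0`. [folklore] -/
private theorem eq_zero_of_forall_localPairing_eq_zero' (hTd : IsUnit T.det) {y : Fin N → v.adicCompletion F}
    (h : ∀ x, localPairing F N T v x y = 0) : y = 0 := by
  obtain ⟨u, hu⟩ := isUnit_localGram F N T v hTd
  have hTy : localGram F N T v *ᵥ y = 0 := by
    funext i
    have := h (Pi.single i 1)
    rw [Matrix.toLinearMap₂'_apply', single_dotProduct, one_mul] at this
    exact this
  have : ((u⁻¹ : (Matrix (Fin N) (Fin N) (v.adicCompletion F))ˣ) : Matrix _ _ _) *ᵥ (localGram F N T v *ᵥ y) = y := by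
    rw [Matrix.mulVec_mulVec, ← hu, Units.inv_mul, Matrix.one_mulVec]
  rw [← this, hTy, Matrix.mulVec_zero]

/-- the commutator form `A = alt (polar β_{𝕋_v})`, `A((x,y),(x',y')) = ⟨x, 𝕋_v y'⟩ - ⟨x', 𝕋_v y⟩`, is alternating.
[cite: Rangarao1993, §2.1] -/
theorem isAlt_alt_polar : LinearMap.IsAlt (alt (polar (localPairing F N T v))) :=
  fun _ => sub_self _

/-- … and non-degenerate, `det 𝕋_v` being a unit. [cite: Rangarao1993, §2.1] -/
theorem nondegenerate_alt_polar (hTd : IsUnit T.det) : (alt (polar (localPairing F N T v))).Nondegenerate := by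
  have hL : (alt (polar (localPairing F N T v))).SeparatingLeft := by
    intro p hp
    have h1 : p.1 = 0 := eq_zero_of_forall_localPairing_eq_zero F N T v hTd fun y' => by
      have := hp (0, y')
      simpa [alt_apply, polar_apply] using this
    have h2 : p.2 = 0 := eq_zero_of_forall_localPairing_eq_zero' F N T v hTd fun x' => by
      have := hp (x', 0)
      simpa [alt_apply, polar_apply] using this
    exact Prod.ext h1 h2
  exact (LinearMap.IsRefl.nondegenerate_iff_separatingLeft (isAlt_alt_polar F N T v).isRefl).2 hL

/-- `ℓ = 0 × Y_v` is Lagrangian: `ℓ^⊥ = ℓ` for `alt (polar β_{𝕋_v})`. [cite: Rangarao1993, §2.1] -/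
theorem orthogonal_lagrangianY (hTd : IsUnit T.det) :
    LinearMap.BilinForm.orthogonal (alt (polar (localPairing F N T v))) (lagrangianY F N v) = lagrangianY F N v := by
  ext m
  rw [LinearMap.BilinForm.mem_orthogonal_iff]
  constructor
  · intro h
    have hx : m.1 = 0 := eq_zero_of_forall_localPairing_eq_zero F N T v hTd fun y' => by
      have := h (0, y') (Submodule.mem_prod.2 ⟨(Submodule.mem_bot _).2 rfl, Submodule.mem_top⟩)
      simpa [alt_apply, polar_apply] using this
    exact Submodule.mem_prod.2 ⟨(Submodule.mem_bot _).2 hx, Submodule.mem_top⟩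
  · intro hm n hn
    have hm1 : m.1 = 0 := (Submodule.mem_bot _).1 (Submodule.mem_prod.1 hm).1
    have hn1 : n.1 = 0 := (Submodule.mem_bot _).1 (Submodule.mem_prod.1 hn).1
    simp [alt_apply, polar_apply, hm1, hn1]

/-- `β_{𝕋_v}(·, y)` is continuous (a linear form on the finite-dimensional `F_vᴺ`). [folklore] -/
private theorem continuous_localPairing_left (y : Fin N → v.adicCompletion F) :
    Continuous fun u : Fin N → v.adicCompletion F => localPairing F N T v u y := by
  simp only [Matrix.toLinearMap₂'_apply', dotProduct]
  exact continuous_finsetSum _ fun i _ => (continuous_apply i).mul continuous_const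

/-- **the local smooth Schrödinger model** `ρ_v` of `H(𝕎_v)` on `𝒮(F_vᴺ)` for `ψ_v = adeleAddCharAt F v`
(tree `schrodingerSB` at `β_{𝕋_v}`): `(ρ_v((x,y),t)Φ)(u) = ψ_v(t + ⟨u, 𝕋_v y⟩) Φ(u + x)` — placewise the same
formula as the global `adelicSchrodinger F (Fin N) 𝕋`. [cite: MoeglinVignerasWaldspurger1987, Chap. 2 I.4 Exemple (1)] -/
def localSchrodinger :
    Representation ℂ (Heisenberg (polar (localPairing F N T v))) (SchwartzBruhat (Fin N → v.adicCompletion F)) :=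
  schrodingerSB (localPairing F N T v) (adeleAddCharAt F v)
    (isLocallyConstant_of_isContinuousNontrivial (isContinuousNontrivial_adeleAddCharAt F v))
    (continuous_localPairing_left F N T v)

/-- the local metaplectic group of pairs `S̃p_{ψ_v}(𝕎_v) = {(g, M) : M implements g on 𝒮(F_vᴺ)}` (MVW II.1).
[cite: MoeglinVignerasWaldspurger1987, Chap. 2 II.1 (B)] -/
abbrev LocalMp : Type := MpPsi (localSchrodinger F N T v)

variable [MeasurableSpace (v.adicCompletion F)] [BorelSpace (v.adicCompletion F)]
  (μ : Measure (v.adicCompletion F)) [μ.IsAddHaarMeasure]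

variable (ψ' : AddChar (v.adicCompletion F) Circle) (hψ' : ψ'.IsContinuousNontrivial)
  (ℓ : Submodule (v.adicCompletion F) ((Fin N → v.adicCompletion F) × (Fin N → v.adicCompletion F)))
  (hℓ : LinearMap.BilinForm.orthogonal (alt (polar (localPairing F N T v))) ℓ = ℓ)

/-- **the Leray cocycle of `Sp(𝕎_v)` w.r.t. a Lagrangian `ℓ` and a character `ψ'`** (`hℓ : ℓ^⊥ = ℓ`; e.g.
`ℓ = lagrangianY`, or the restriction of scalars of a maximal isotropic `E_v`-subspace such as Kudla's diagonal `Δ`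
of a doubled space; `ψ'` any continuous non-trivial character of `F_v` — the normalised section of the Schrödinger
model at `ψ_v` has the Leray cocycle of `ψ' = ψ_v(½·)` as multiplier, [Rangarao1993, Thm 4.1 (5)]),
`c^{ψ'}_ℓ(g₁, g₂) = γ_{ψ'}(τ(ℓ, g₁ℓ, g₁g₂ℓ)) ∈ ℂˣ`, as a central `2`-cocycle on `LocalSp` (tree `lerayCentralCocycle`;
`symplecticGroup (polar β) = isometries (alt (polar β))` by `rfl`). [cite: MoeglinVignerasWaldspurger1987, Chap. 3 §I.3] -/
def localLeray : Literature.GroupTheory.CentralCocycle (LocalSp F N T v) ℂˣ :=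
  lerayCentralCocycle μ hψ' (isAlt_alt_polar F N T v) (nondegenerate_alt_polar F N T v hTd) hℓ

/-! ## §2 The local embedding `ι_v : U(J)(F_v) → Sp(𝕎_v)` -/

/-- `ι_v` on the factor form `localPi` of the local unitary group (the tree's `UnitaryGroup.localPiToSymplectic`;
restated here only to fix the argument list). [cite: MoeglinVignerasWaldspurger1987, Ch. 1 I.17] -/
def iota : UnitaryGroup.localPi E c N J v →* LocalSp F N T v :=
  UnitaryGroup.localPiToSymplectic E c N v hcδ hδ hd hT hJ

omit [MeasurableSpace (v.adicCompletion F)] [BorelSpace (v.adicCompletion F)] in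
/-- unfolding lemma for `iota` (the definition is made IRREDUCIBLE below: unifying `ι g` against patterns such as
`?a * ?b` must never unfold the tree's quadratic-coordinate construction — it is huge). [cite: MoeglinVignerasWaldspurger1987, Ch. 1 I.17] -/
theorem iota_def : iota F E c N hcδ hδ hd T hT hJ v = UnitaryGroup.localPiToSymplectic E c N v hcδ hδ hd hT hJ := rfl

attribute [irreducible] iota

/-! ## §3 THE DATUM delivered by GR-1 at the place `v` -/

/-- **The local non-archimedean splitting datum at `v` relative to the Lagrangian `ℓ`** (GR-1's deliverable; K3-residual + K4-fin of the shared
work-breakdown).  Fields: `r` — a normalised implementer section of the Schrödinger model whose multiplier is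
a Leray cocycle `c^{ψ'}_ℓ` of `ℓ` for SOME continuous non-trivial character `ψ'` of `F_v` (Rao's standard section
gives `ψ' = ψ_v(½·)`, [Rangarao1993, Thm 4.1 (5) / 5.3]; [MoeglinVignerasWaldspurger1987, Chap. 3 I.3]); `beta` —
Kudla's splitting function on `U(J)(F_v)` with `β(gg') · c_r(ι g, ι g') = β(g) β(g')` for the multiplier `c_r` of
`r` ([Kudla1994, Thm 3.1]; [HarrisKudlaSweet1996, §1 (1.15)–(1.19)]); every `Φ ∈ 𝒮(F_vᴺ)` fixed by
`β(k)⁻¹ r(ι k)` for `k` in an open subgroup (smoothness, [MoeglinVignerasWaldspurger1987, Chap. 2 II.8]).  The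
normalisation of the cocycle (which `ψ'`) is deliberately NOT pinned by the type: `∂β` is stated against the
multiplier of `r` itself, so that the derived splitting is a homomorphism for any normalisation.  A DATA structure
(Type-valued) to be INSTANTIATED, not a hypothesis of the end theorem. [cite: Kudla1994, Thm 3.1] -/
structure LocalSplittingDatum where
  /-- the Leray-normalised section of implementers on `𝒮(F_vᴺ)` -/
  r : ImplementerSection (localSchrodinger F N T v)
  /-- implementers are unique up to scalars on the smooth model (K3a, transported from `…_schrodingerSB_pi`) -/
  hU : ImplementerUniqueUpToScalar (localSchrodinger F N T v)
  /-- the multiplier of `r` IS a Leray cocycle of `ℓ`: `r(g₁) r(g₂) = c^{ψ'}_ℓ(g₁, g₂) r(g₁g₂)` for some continuous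
  non-trivial `ψ'` (Rao: `ψ' = ψ_v(½·)`) -/
  cocycle_eq : ∃ (ψ' : AddChar (v.adicCompletion F) Circle) (hψ' : ψ'.IsContinuousNontrivial),
    ∀ g₁ g₂ : LocalSp F N T v, r.cocycle hU g₁ g₂ = localLeray F N T hTd v μ ψ' hψ' ℓ hℓ g₁ g₂
  /-- Kudla's splitting function -/
  beta : UnitaryGroup.localPi E c N J v → ℂˣ
  /-- normalisation -/
  beta_one : beta 1 = 1
  /-- `∂β = c_r ∘ ι`, `c_r` the multiplier of `r` -/
  beta_mul : ∀ g₁ g₂ : UnitaryGroup.localPi E c N J v,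
    beta (g₁ * g₂) * r.cocycle hU (iota F E c N hcδ hδ hd T hT hJ v g₁) (iota F E c N hcδ hδ hd T hT hJ v g₂) =
      beta g₁ * beta g₂
  /-- SMOOTHNESS of the genuine representation `k ↦ β(k)⁻¹ r(ι k)` of `U(J)(F_v)` (topology of the closed subgroup of
  `Π_{w ∣ v} GL_N(E_w)`): every Schwartz–Bruhat function is fixed on an open subgroup.  (Only this combination is
  asserted: `β` alone is NOT continuous across Bruhat cells.) -/
  smooth : ∀ Φ : SchwartzBruhat (Fin N → v.adicCompletion F), ∃ U : Subgroup (UnitaryGroup.localPi E c N J v),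
    IsOpen (U : Set (UnitaryGroup.localPi E c N J v)) ∧
      ∀ k ∈ U, ((beta k)⁻¹ : ℂˣ) • r (iota F E c N hcδ hδ hd T hT hJ v k) Φ = Φ

namespace LocalSplittingDatum

variable {F E c N hcδ hδ hd T hT hTd hJ v μ ℓ hℓ}
variable (D : LocalSplittingDatum F E c N hcδ hδ hd T hT hTd hJ v μ ℓ hℓ)

/-- the underlying function of the local splitting: `g ↦ i(β(g))⁻¹ · (ι g, r(ι g))`. [cite: GelbartRogawski1991, §3.1 Prop. 3.1.1 p. 455 L1–3] -/
def localSplittingFun (g : UnitaryGroup.localPi E c N J v) : LocalMp F N T v :=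
  MpPsi.ofScalar _ (D.beta g)⁻¹ * D.r.secMpPsi (iota F E c N hcδ hδ hd T hT hJ v g)

/-- `s_v(1) = 1`. [cite: GelbartRogawski1991, §3.1 Prop. 3.1.1 p. 455 L1–3] -/
theorem localSplittingFun_one : D.localSplittingFun 1 = 1 := by
  rw [localSplittingFun, D.beta_one, inv_one, (MpPsi.ofScalar _).map_one,
    (iota F E c N hcδ hδ hd T hT hJ v).map_one, ImplementerSection.secMpPsi_one, one_mul]

/-- `β(g₁g₂)⁻¹ = β(g₁)⁻¹ β(g₂)⁻¹ c_r(ι g₁, ι g₂)` — `beta_mul` inverted. [cite: Kudla1994, Thm 3.1] -/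
theorem beta_mul_inv (g₁ g₂ : UnitaryGroup.localPi E c N J v) :
    (D.beta (g₁ * g₂))⁻¹ = (D.beta g₁)⁻¹ * (D.beta g₂)⁻¹ *
      D.r.cocycle D.hU (iota F E c N hcδ hδ hd T hT hJ v g₁) (iota F E c N hcδ hδ hd T hT hJ v g₂) := by
  rw [eq_mul_inv_of_mul_eq (D.beta_mul g₁ g₂), mul_inv, mul_inv, inv_inv]

/-- group algebra behind `s_v(g₁g₂) = s_v(g₁)s_v(g₂)`: central scalars commute past the sections. [folklore] -/
private theorem _root_.Literature.NumberTheory.GelbartRogawski1991.UnitaryDualPair.LocalSplitting.mul_rearrange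
    {G : Type*} [Group G] (z₁ z₂ zc s₁ s₂ s₁₂ : G) (hz₂ : s₁ * z₂ = z₂ * s₁) (hsec : s₁ * s₂ = zc * s₁₂) :
    z₁ * z₂ * zc * s₁₂ = z₁ * s₁ * (z₂ * s₂) := by
  calc z₁ * z₂ * zc * s₁₂ = z₁ * z₂ * (zc * s₁₂) := by rw [mul_assoc]
    _ = z₁ * z₂ * (s₁ * s₂) := by rw [hsec]
    _ = z₁ * (z₂ * s₁) * s₂ := by rw [← mul_assoc, mul_assoc z₁]
    _ = z₁ * (s₁ * z₂) * s₂ := by rw [hz₂]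
    _ = z₁ * s₁ * (z₂ * s₂) := by rw [← mul_assoc, mul_assoc]

/-- `s_v(g₁g₂) = s_v(g₁) s_v(g₂)` — from `∂β = c_r` (`beta_mul`), the multiplication
law of pairs (`secMpPsi_mul`) and centrality of `i(ℂˣ)`. [cite: GelbartRogawski1991, §3.1 Prop. 3.1.1 p. 455 L1–3] -/
theorem localSplittingFun_mul (g₁ g₂ : UnitaryGroup.localPi E c N J v) :
    D.localSplittingFun (g₁ * g₂) = D.localSplittingFun g₁ * D.localSplittingFun g₂ := by
  haveI : Nontrivial (SchwartzBruhat (Fin N → v.adicCompletion F)) := nontrivial_schwartzBruhat_pi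
  have hz : ∀ (a : ℂˣ) (x : LocalMp F N T v), x * MpPsi.ofScalar _ a = MpPsi.ofScalar _ a * x :=
    fun a x => Subgroup.mem_center_iff.1 (MpPsi.ofScalar_mem_center _ a) x
  have hsec := D.r.secMpPsi_mul D.hU (iota F E c N hcδ hδ hd T hT hJ v g₁) (iota F E c N hcδ hδ hd T hT hJ v g₂)
  have hA : MpPsi.ofScalar (localSchrodinger F N T v) (D.beta (g₁ * g₂))⁻¹ =
      MpPsi.ofScalar _ (D.beta g₁)⁻¹ * MpPsi.ofScalar _ (D.beta g₂)⁻¹ *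
        MpPsi.ofScalar _ (D.r.cocycle D.hU (iota F E c N hcδ hδ hd T hT hJ v g₁) (iota F E c N hcδ hδ hd T hT hJ v g₂)) :=
    (congrArg (MpPsi.ofScalar (localSchrodinger F N T v)) (D.beta_mul_inv g₁ g₂)).trans
      (((MpPsi.ofScalar (localSchrodinger F N T v)).map_mul _ _).trans
        (congrArg (· * MpPsi.ofScalar (localSchrodinger F N T v) _) ((MpPsi.ofScalar (localSchrodinger F N T v)).map_mul _ _)))
  have hB := congrArg D.r.secMpPsi ((iota F E c N hcδ hδ hd T hT hJ v).map_mul g₁ g₂)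
  exact (congrArg₂ (· * ·) hA hB).trans (mul_rearrange _ _ _ _ _ _ (hz _ _) hsec)

/-- **the local splitting** `s_v : U(J)(F_v) →* S̃p_{ψ_v}(𝕎_v)`, `s_v(g) = i(β(g))⁻¹ · (ι g, r(ι g))` — a
genuine homomorphism because `∂β = c_r`, the multiplier of `r`. [cite: GelbartRogawski1991, §3.1 Prop. 3.1.1 p. 455 L1–3] -/
def localSplitting : UnitaryGroup.localPi E c N J v →* LocalMp F N T v where
  toFun := D.localSplittingFun
  map_one' := D.localSplittingFun_one
  map_mul' := D.localSplittingFun_mul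

/-- `π ∘ s_v = ι_v`. [cite: GelbartRogawski1991, §3.1 Prop. 3.1.1 p. 455 L1–3] -/
theorem proj_localSplitting (g : UnitaryGroup.localPi E c N J v) :
    MpPsi.proj _ (D.localSplitting g) = iota F E c N hcδ hδ hd T hT hJ v g := by
  show MpPsi.proj _ (MpPsi.ofScalar _ (D.beta g)⁻¹ * D.r.secMpPsi (iota F E c N hcδ hδ hd T hT hJ v g)) = _
  rw [map_mul, MpPsi.proj_ofScalar, one_mul, ImplementerSection.proj_secMpPsi]

/-- **the local Weil representation of `U(J)(F_v)` on `𝒮(F_vᴺ)` BY IMPLEMENTERS**, `ω_v = (tautological rep) ∘ s_v`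
— the placewise input `r v` of `Automorphic/FiniteAdeleWeilAssembly.finiteAdeleRep` (K7). [cite: MoeglinVignerasWaldspurger1987, Chap. 2 II.1] -/
def localOmega : Representation ℂ (UnitaryGroup.localPi E c N J v) (SchwartzBruhat (Fin N → v.adicCompletion F)) :=
  (MpPsi.toRep (localSchrodinger F N T v)).comp D.localSplitting

/-- formula: `ω_v(g) Φ = β(g)⁻¹ • r(ι g) Φ`. [cite: MoeglinVignerasWaldspurger1987, Chap. 2 II.1] -/
theorem localOmega_apply (g : UnitaryGroup.localPi E c N J v) (Φ : SchwartzBruhat (Fin N → v.adicCompletion F)) :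
    D.localOmega g Φ = ((D.beta g)⁻¹ : ℂˣ) • D.r (iota F E c N hcδ hδ hd T hT hJ v g) Φ :=
  rfl

/- THE UNRAMIFIED CLAUSE at `v` (K5; [GelbartRogawski1991, §3.1 (3.1.3), p. 456]; MVW Chap. 2 II.10) is the statement
   `∀ k ∈ UnitaryGroup.localInt E c N J v, D.localOmega k (unitVec F (Fin N) v) = unitVec F (Fin N) v`
   (`U(J)(𝒪_v)` fixes `1_{𝒪_vᴺ}` through `ω_v`), to be proved `∀ᶠ v in Filter.cofinite` for the constructed data — the
   hypothesis `hK` of `finiteAdeleRep`.  It is stated inline by its consumers (no `Prop`-valued definition here). -/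

end LocalSplittingDatum

end Literature.NumberTheory.GelbartRogawski1991.UnitaryDualPair.LocalSplitting

end
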